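import Summits.HodgeConjecture.CorCM.GaloisCyclicSemidirectEightNormPairs
import HarnessLib

/-!
# `μ₄`-norm-pair certificates: `C_p ⋊ C₈` is BAD for `p = 43`

COR-CM (cell `pub-hodgecm2`), binder seat b04 (gen 29), count-neutral claim CYCLIC-SEMIDIRECT-EIGHT-DEGENERATE — instances
of part V (`GaloisCyclicSemidirectEight.exists_simple_degenerate_of_normPair`): a Galois CM field `K` with `Gal(K/ℚ) ≅ C_p ⋊
C₈` (`φ(1)` = inversion) carries a simple DEGENERATE CM abelian `4p`-fold with a rational `(q,q)` class outside the divisor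
ring on some power as soon as `ℤ/p` has a `μ₄`-norm pair `(k₀, k₁)` (sheets `kⱼ : ℤ/p → ℤ/4` whose two balance identities
make the coefficient of `ζ^d` in `G₀(ζ)G₀(ζ⁻¹) − i·G₁(ζ)G₁(ζ⁻¹)`, `Gⱼ(ζ) = Σ_v i^{kⱼ(v)} ζ^v`, independent of `d`); the
certificate is two vectors in `(ℤ/4)^p`, checked by `decide` on `ℤ/p` alone.  scratch/note_c8B.txt  KERNEL ONLY: theorems;
no definition, no named fact, no `sorry`.  `HC_CM` is neither used nor claimed.

## References

* [Kubota1965] T. Kubota, *On the field extension by complex multiplication*, Trans. AMS 118 (1965), §2, §4 Lemma 2.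
* [Shimura1998] G. Shimura, *Abelian Varieties with Complex Multiplication and Modular Functions*, §6.2 Thm. 3, §8.2 Prop. 26.
* [Gordon1999HodgeAVSurvey] B. B. Gordon, *A survey of the Hodge conjecture for abelian varieties*, Thm. 6.4, §9.3.
-/

noncomputable section

open CategoryTheory CategoryTheory.Limits NumberField
open scoped BigOperators

namespace Summit.HodgeConjecture.CorCM.GaloisCyclicSemidirectEight

open Literature.NumberTheory.ComplexMultiplication
open Literature.AlgebraicGeometry.Motives (AbelianVariety CMType)
open Literature.AlgebraicGeometry.HodgeTheory
open Literature.AlgebraicGeometry.ComplexMultiplication (IsCMTypeRealisation)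
open Literature.AlgebraicGeometry.Pohlmann1968
open Literature.Barriers.HodgeConjecture (divisorClassesSpan)

variable {K : Type} [Field K] [NumberField K] [IsCMField K] [IsGalois ℚ K]

/-- **`Gal(K/ℚ) ≅ C_43 ⋊ C₈` is BAD**: the `μ₄`-norm pair `k₀ = [1, 3, 3, 2, 2, 0, 3, 3, 0, 3, 1, 3, 3, 0, 0, 2, 1, 1, 2, 0, 0,
0, 2, 3, 2, 0, 0, 0, 0, 3, 0, 0, 0, 0, 0, 0, 3, 3, 0, 0, 0, 0, 3]`, `k₁ = [1, 1, 1, 1, 2, 0, 1, 2, 0, 1, 0, 1, 1, 0, 1, 2,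
0, 0, 1, 0, 3, 0, 1, 1, 2, 0, 0, 0, 0, 1, 0, 1, 3, 0, 3, 0, 1, 2, 0, 0, 0, 1, 2]` in `ℤ/43` (both sheets constant on the
cosets of the subgroup of order `3` of `(ℤ/43)ˣ`) (in the proof `kⱼ(v)` is the `v`-th base-`4` digit of the numeral `Nⱼ =
Σ_v kⱼ(v)·4^v`) gives a simple DEGENERATE abelian `172`-fold with CM by `K` and a rational `(q,q)` class outside the divisor
ring on some power. [cite: Kubota1965, §4 Lemma 2] [cite: Shimura1998, §6.2 Thm. 3 and §8.2 Prop. 26] [cite: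
Gordon1999HodgeAVSurvey, Thm. 6.4 and §9.3] -/
theorem exists_simple_degenerate_cyclic43_semidirect8_normPair
    (φ : Multiplicative (ZMod 8) →* MulAut (Multiplicative (ZMod 43)))
    (hφ : ∀ v : Multiplicative (ZMod 43), φ (Multiplicative.ofAdd 1) v = v⁻¹)
    (e : (K ≃ₐ[ℚ] K) ≃* Multiplicative (ZMod 43) ⋊[φ] Multiplicative (ZMod 8)) :
    ∃ (Φ : CMType K) (φ₀ : K →+* ℂ) (A : AbelianVariety ℂ) (ι : 𝓞 K →+* End A)
      (θ : K →+* Module.End ℂ (complexBetti A.X 1)),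
      IsPrimitive (ℂ ≃+* ℂ) Φ.1 φ₀ ∧ ¬ IsNondegenerate Φ ∧ IsCMTypeRealisation Φ A ι θ ∧ A.IsSimple ∧ A.dim = 172 ∧
      ∃ n q : ℕ, ∃ x : complexBetti (⨁ fun _ : Fin n => A).X (2 * q), IsRationalClass x ∧
        IsOfHodgeType (⨁ fun _ : Fin n => A).dim (⨁ fun _ : Fin n => A).X (2 * q) q q x ∧
        x ∉ divisorClassesSpan (⨁ fun _ : Fin n => A).X (⨁ fun _ : Fin n => A).dim q := by
  -- the sheets are read off the base-`4` digits of two numerals (`kⱼ(v)` = digit `v` of `Nⱼ`): `decide +kernel` then costs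
  -- `O(1)` GMP operations per evaluation instead of a length-`43` `![…]` lookup
  obtain ⟨Φ, φ₀, A, ι, θ, h1, h2, h3, h4, h5, h6⟩ := @exists_simple_degenerate_of_normPair 43 ⟨by norm_num⟩ K _ _ _ _
    (by norm_num) φ hφ e
    (fun v : ZMod 43 => (((58099275704245775203365565 : ℕ) / 4 ^ v.val % 4 : ℕ) : ZMod 4))
    (fun v : ZMod 43 => (((43564776488990911437771349 : ℕ) / 4 ^ v.val % 4 : ℕ) : ZMod 4))
    ⟨1, by decide +kernel⟩ (by decide +kernel) (by decide +kernel)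
  exact ⟨Φ, φ₀, A, ι, θ, h1, h2, h3, h4, by norm_num at h5; exact h5, h6⟩

end Summit.HodgeConjecture.CorCM.GaloisCyclicSemidirectEight

end
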